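import Literature.AlgebraicGeometry.Hu2025.Statements.S06WpEllBlowups.R108aWpEllChart
import Mathlib.Algebra.GroupWithZero.NonZeroDivisors
import HarnessLib

/-!
# Hu 2025 (arXiv:2507.21400v1), §6.3 — Prop. 6.11 items (1)–(9) and (◇e), Def. 6.12 (+ the covering sentence C51L148),
# Cor. 6.13 / Rem. 6.14 (chart-level readings), Prop. 6.15, Def. 6.17: statements-first typing, file b = `S06WpEllBlowups/R108bProp611Items.lean` of
# lit/PARTITION-HU.md row 108 (imports file a `R108aWpEllChart` for `WpEllChart`, `IsAdmissible`, `IsSmoothAlg`; see file a's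
# header for the carrier level and the locator conventions) —
# typed for lit/PARTITION-HU.md row 108 by res-type-081 (typer of record; M-Hu-min re-pointing line 2026-08-27T08:00:07Z) from
# res-type-029's FILING-READY SPLIT v2 pre-draft (2026-08-27T04:4xZ) with res-type-081's T9 locator audit
# (HOME/plan/tools/res-type-081/hu/T9-AUDIT-row108.md); every locator below was re-read on the TeX chunks of record.

**STATUS OF THE SOURCE (D-0012 / D-0089): UNREFEREED PREPRINT UNDER ADJUDICATION** — [Hu2025] arXiv:2507.21400v1,
`paper:arxiv-2507.21400`, locators `C<cc>L<l>` + PDF page. Statements below are `def … : Prop` CANDIDATES tagged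
`[claim: Hu2025, status: under-review]` — «STATUS: candidate statement under adjudication (D-0012/D-0089); not asserted»;
nothing is proved, nothing is asserted, no declaration takes a side. AI typing, weaker than expert review.
-/

noncomputable section

open MvPolynomial

namespace Literature.AlgebraicGeometry.Hu2025.Statements.S06WpEllBlowups

universe u v w u₁ u₂ u₃ u₄

variable (R : Type u) [CommRing R]

section Items

variable {R}
variable {ι₁ : Type u₁} {ι₂ : Type u₂} {ιF : Type u₃} {ιE : Type u₄} {A : Type w} [CommRing A] [Algebra R A]
  [DecidableEq ι₂]

/-- **Prop. 6.11 (1)** (C48L1–L3; PDF p.108 item (1)). «the divisor X_{(℘_(kτ)𝔯_μ𝔰_h),w} ∩ 𝔙 is defined by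
(x_{𝔙,w} = 0) for every w ∈ 𝕀⋆_{3,n} ∖ 𝔢_𝔙».
[claim: Hu2025, status: under-review]
STATUS: candidate statement under adjudication (D-0012/D-0089); not asserted. -/
def Prop6_11_1 (C : WpEllChart ι₁ ι₂ ιF ιE A) : Prop :=
  IsAdmissible C → ∀ w ∉ C.eps, C.plDiv w = Ideal.span {C.var₁ w}

/-- **Prop. 6.11 (2)** (C48L5–L6; PDF p.108 item (2)). «the divisor X_{(℘_(kτ)𝔯_μ𝔰_h),(u,v)} ∩ 𝔙 is defined by
(x_{𝔙,(u,v)} = 0) for every (u, v) ∈ Λ⋆_𝔉 ∖ 𝔡_𝔙».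
[claim: Hu2025, status: under-review]
STATUS: candidate statement under adjudication (D-0012/D-0089); not asserted. -/
def Prop6_11_2 (C : WpEllChart ι₁ ι₂ ιF ιE A) : Prop :=
  IsAdmissible C → ∀ uv ∉ C.del, C.rhoDiv uv = Ideal.span {C.var₂ uv}

/-- **Prop. 6.11 (3)** (C48L8; PDF p.108 item (3)). «the divisor X_{(℘_(kτ)𝔯_μ𝔰_h),w} does not intersect the chart
for all w ∈ 𝔢_𝔙». Typed: chart ideal `= ⊤`.
[claim: Hu2025, status: under-review]
STATUS: candidate statement under adjudication (D-0012/D-0089); not asserted. -/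
def Prop6_11_3 (C : WpEllChart ι₁ ι₂ ιF ιE A) : Prop :=
  IsAdmissible C → ∀ w ∈ C.eps, C.plDiv w = ⊤

/-- **Prop. 6.11 (4)** (C48L10; PDF p.108 item (4)). «the divisor X_{(℘_(kτ)𝔯_μ𝔰_h),(u,v)} does not intersect the
chart for all (u, v) ∈ 𝔡_𝔙».
[claim: Hu2025, status: under-review]
STATUS: candidate statement under adjudication (D-0012/D-0089); not asserted. -/
def Prop6_11_4 (C : WpEllChart ι₁ ι₂ ιF ιE A) : Prop :=
  IsAdmissible C → ∀ uv ∈ C.del, C.rhoDiv uv = ⊤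

/-- **Prop. 6.11 (5)** (C48L12–L15; PDF p.108 item (5)). «the ϖ-exceptional divisor E_{(℘_(kτ)𝔯_μ𝔰_h),w} ∩ 𝔙 labeled
by an element w ∈ 𝔢_𝔙 is define [sic] by (ε_{𝔙,w} = 0) for all w ∈ 𝔢_𝔙». Typed through the label map: a divisor
labelled `w` (then `w ∈ 𝔢_𝔙` by `Prop6_11_labels`) has chart ideal `(ε_{𝔙,w})` = the span of the `Var_𝔙`-variable of
index `w`.
[claim: Hu2025, status: under-review]
STATUS: candidate statement under adjudication (D-0012/D-0089); not asserted. -/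
def Prop6_11_5 (C : WpEllChart ι₁ ι₂ ιF ιE A) : Prop :=
  IsAdmissible C → ∀ E w, C.lab E = some (Sum.inl w) → C.excDiv E = Ideal.span {C.var₁ w}

/-- **Prop. 6.11 (6)** (C48L17–L20; PDF p.108 item (6)). «the ϱ-exceptional divisor E_{(℘_(kτ)𝔯_μ𝔰_h),(u,v)} ∩ 𝔙
labeled by an element (u, v) ∈ 𝔡_𝔙 is define [sic] by (δ_{𝔙,(u,v)} = 0) for all (u, v) ∈ 𝔡_𝔙». Typed through the
label map with the printed symbol `δ_{𝔙,(u,v)}` resolved by `WpEllChart.delta` (for `(u,v) = (m,u_F) ∈ 𝔡^lt_𝔙` this is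
the ℓ-exceptional variable, the same function item (7) names — AS PRINTED; see module docstring).
[claim: Hu2025, status: under-review]
STATUS: candidate statement under adjudication (D-0012/D-0089); not asserted. -/
def Prop6_11_6 (C : WpEllChart ι₁ ι₂ ιF ιE A) : Prop :=
  IsAdmissible C → ∀ E uv, C.lab E = some (Sum.inr (Sum.inl uv)) → C.excDiv E = Ideal.span {C.delta uv}

/-- **Prop. 6.11 (7)** (C48L22–L25; PDF p.108 item (7)). «the 𝔩-exceptional divisor E_{ℓ_k,L_F} ∩ 𝔙 labeled by an
element L_F ∈ 𝔩_𝔙 is define [sic] by (δ_{𝔙,(m,u_F)} = 0) for all L_F ∈ 𝔩_𝔙».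
[claim: Hu2025, status: under-review]
STATUS: candidate statement under adjudication (D-0012/D-0089); not asserted. -/
def Prop6_11_7 (C : WpEllChart ι₁ ι₂ ιF ιE A) : Prop :=
  IsAdmissible C → ∀ E F uv, C.lab E = some (Sum.inr (Sum.inr F)) → C.ltIdx F = some uv →
    C.excDiv E = Ideal.span {C.deltaEll uv}

/-- **Prop. 6.11 (8)** (C48L27–L30; PDF p.108 item (8)). «any of the remaining exceptional divisors of
ℛ̃_{(℘_(kτ)𝔯_μ𝔰_h)} other than those that are labelled by some w ∈ 𝔢_𝔙 or (u,v) ∈ 𝔡_𝔙 or L ∈ 𝔩_𝔙 does not intersect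
the chart.»
[claim: Hu2025, status: under-review]
STATUS: candidate statement under adjudication (D-0012/D-0089); not asserted. -/
def Prop6_11_8 (C : WpEllChart ι₁ ι₂ ιF ιE A) : Prop :=
  IsAdmissible C → ∀ E, C.lab E = none → C.excDiv E = ⊤

/-- **Prop. 6.11 (◇e)** (C48L32; PDF p.108 «(◇e) In particular, all the aforementioned divisors are smooth.»). Typed:
the quotient of the chart ring by the chart ideal of each divisor of items (1), (2), (5)–(7) that meets the chart is a
smooth `R`-algebra.
[claim: Hu2025, status: under-review]
STATUS: candidate statement under adjudication (D-0012/D-0089); not asserted. -/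
def Prop6_11_e (C : WpEllChart ι₁ ι₂ ιF ιE A) : Prop :=
  IsAdmissible C →
    (∀ w ∉ C.eps, IsSmoothAlg R (A ⧸ C.plDiv w)) ∧
    (∀ uv ∉ C.del, IsSmoothAlg R (A ⧸ C.rhoDiv uv)) ∧
    (∀ E, (C.lab E).isSome → IsSmoothAlg R (A ⧸ C.excDiv E))

/-- **Prop. 6.11 (9), first clause** (C48L34–L39; PDF p.108–109 item (9)). «Assume (℘_(kτ)𝔯_μ𝔰_h) = ℓ_k. Fix and
consider any j ∈ [k]. Suppose 𝔙 lies over the admissible affine chart (x_{(m,u_{F_j})} ≡ 1) of ℛ. Then,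
L_{F_j} ∉ 𝔩_𝔙, and the ℓ_j-blowup is trivial.» Typed with explicit parameters: `isEllK` (the stage is `ℓ_k`),
`blocks` (= `{F_j ∣ j ∈ [k]}`), the position predicate `liesOverPl F` («𝔙 lies over the chart (x_{(m,u_F)} ≡ 1) of
ℛ», row 106's chart words), and the slot `ellTrivial F` for «the ℓ_j-blowup is trivial» (scheme-level, row 110).
[claim: Hu2025, status: under-review]
STATUS: candidate statement under adjudication (D-0012/D-0089); not asserted. -/
def Prop6_11_9a (isEllK : Prop) (blocks : Finset ιF) (liesOverPl : ιF → Prop) (ellTrivial : ιF → Prop)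
    (C : WpEllChart ι₁ ι₂ ιF ιE A) : Prop :=
  isEllK → IsAdmissible C → ∀ F ∈ blocks, liesOverPl F → F ∉ C.ell ∧ ellTrivial F

/-- **Prop. 6.11 (9), second clause** (C48L41–L55; PDF p.109 item (9) cont.). «Suppose 𝔙 lies over the ϱ-standard
chart of ℛ̃_{ϑ[j]}. Then, L_{F_j} ∈ 𝔩_𝔙, and we can choose admissible affine charts of ℛ̃_{ℓ_k} such that they cover
𝒱̃_{ℓ_k}, and on any such chart 𝔙, we can express L_{𝔙,F_j} = 1 + sgn(s_{F_j}) y_{𝔙,(m,u_{F_j})} where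
y_{𝔙,(m,u_{F_j})} ∈ Var_𝔙 is an invertible variable in Var_𝔙 labelled by (m, u_{F_j}).» Typed PER CHART (the
covering clause «we can choose … cover 𝒱̃_{ℓ_k}» is the scheme-level slot `C51L148`): parameters `isEllK`, `blocks`,
`liesOverRhoStd F` («𝔙 lies over the ϱ-standard chart of ℛ̃_{ϑ[j]}», Def. 5.13–5.15 of row 106), `sgn F ∈ ℤ`
(`sgn(s_F) = ±1`, row 102 I-ORD).
[claim: Hu2025, status: under-review]
STATUS: candidate statement under adjudication (D-0012/D-0089); not asserted. -/
def Prop6_11_9b (isEllK : Prop) (blocks : Finset ιF) (liesOverRhoStd : ιF → Prop) (sgn : ιF → ℤ)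
    (C : WpEllChart ι₁ ι₂ ιF ιE A) : Prop :=
  isEllK → IsAdmissible C → ∀ F ∈ blocks, liesOverRhoStd F →
    F ∈ C.ell ∧ ∃ uv, C.ltIdx F = some uv ∧ C.ellForm F = 1 + (sgn F : A) * C.var₂ uv ∧ IsUnit (C.var₂ uv)

/-- **Prop. 6.11 (9)** (C48L34–L55; PDF p.108–109 item (9)) = the conjunction of its two clauses `Prop6_11_9a`,
`Prop6_11_9b` on the chart.
[claim: Hu2025, status: under-review]
STATUS: candidate statement under adjudication (D-0012/D-0089); not asserted. -/
def Prop6_11_9 (isEllK : Prop) (blocks : Finset ιF) (liesOverPl liesOverRhoStd : ιF → Prop)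
    (ellTrivial : ιF → Prop) (sgn : ιF → ℤ) (C : WpEllChart ι₁ ι₂ ιF ιE A) : Prop :=
  Prop6_11_9a isEllK blocks liesOverPl ellTrivial C ∧ Prop6_11_9b isEllK blocks liesOverRhoStd sgn C

/-! ## Def. 6.12 — preferred admissible charts; the covering sentence -/

/-- **Definition 6.12 (C51L141–L146; p.116).** «An admissible chart of ℛ̃_{(℘_(kτ)𝔯_μ𝔰_h)} as characterized by
Proposition 6.11 (9) will be called a preferred admissible chart.» Typed: an admissible chart on which the
per-chart content of (9) holds (for the given stage/blocks/position/sign parameters).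
[claim: Hu2025, status: under-review]
STATUS: candidate statement under adjudication (D-0012/D-0089); not asserted. -/
def IsPreferred (isEllK : Prop) (blocks : Finset ιF) (liesOverPl liesOverRhoStd : ιF → Prop)
    (ellTrivial : ιF → Prop) (sgn : ιF → ℤ) (C : WpEllChart ι₁ ι₂ ιF ιE A) : Prop :=
  IsAdmissible C ∧ Prop6_11_9 isEllK blocks liesOverPl liesOverRhoStd ellTrivial sgn C

/-- **Definition 6.12 under its printed name** (alias of `IsPreferred`; C51L141–L146; p.116).
[claim: Hu2025, status: under-review]
STATUS: candidate statement under adjudication (D-0012/D-0089); not asserted. -/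
abbrev Def6_12 (isEllK : Prop) (blocks : Finset ιF) (liesOverPl liesOverRhoStd : ιF → Prop)
    (ellTrivial : ιF → Prop) (sgn : ιF → ℤ) (C : WpEllChart ι₁ ι₂ ιF ιE A) : Prop :=
  IsPreferred isEllK blocks liesOverPl liesOverRhoStd ellTrivial sgn C

/-- **The covering sentence after Def. 6.12 (C51L148–L150; p.116).** «By Proposition 6.11 (9), the set of preferred
admissible charts cover 𝒱̃_{(℘_(kτ)𝔯_μ𝔰_h)}.» A statement about the SCHEME `𝒱̃` (row 110 vocabulary); typed here as a
named slot over an abstract family of charts `charts : κ → WpEllChart …` with the scheme-level predicate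
`Covers` («the charts … cover 𝒱̃») as an explicit parameter — the owner instantiates or moves it to row 110.
[claim: Hu2025, status: under-review]
STATUS: candidate statement under adjudication (D-0012/D-0089); not asserted. -/
def C51L148 {κ : Type*} (Covers : (κ → WpEllChart ι₁ ι₂ ιF ιE A) → Prop)
    (IsPreferredChart : WpEllChart ι₁ ι₂ ιF ιE A → Prop) : Prop :=
  ∃ charts : κ → WpEllChart ι₁ ι₂ ιF ιE A, (∀ c, IsPreferredChart (charts c)) ∧ Covers charts

/-! ## Cor. 6.13 / Rem. 6.14 — `𝒱̃_{ℓ_k} → 𝒱̃_{℘_k}` is an isomorphism (chart-level readings; scheme level = row 110) -/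

/-- **Corollary 6.13 (C51L152–L158, proof C51L160–C52L5; p.116–117), CHART-LEVEL reading.** «We let
ρ_{ℓ_k,℘_k} : 𝒱̃_{ℓ_k} → 𝒱̃_{℘_k} be the morphism induced from the blowup morphism ρ_{ℓ_k,℘_k} : ℛ̃_{ℓ_k} → ℛ̃_{℘_k}. Then,
ρ_{ℓ_k,℘_k} is an isomorphism.» (Proof: «ρ^{-1}_{ℓ_k,℘_k}(𝒱̃_{℘_k}) = 𝒱̃_{℘_k} × [1, −sgn(s_{F_k})]», C52L1.) The printed statement
is about SCHEMES (row 110 vocabulary). Typed here on ONE chart pair: `𝔙 = (𝔙' × (ξ_0 ≡ 1)) ∩ ℛ̃_{ℓ_k}` UNSHRUNK over the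
chart `𝔙'` of `ℛ̃_{℘_k}` (hypothesis `fullChart0`; by the proof the whole pre-image of `𝒱̃_{℘_k} ∩ 𝔙'` lies in this chart),
ring map `π : A' → A`, ideals `vIdeal'`, `vIdeal` of `𝒱̃ ∩ 𝔙'`, `𝒱̃ ∩ 𝔙`: the induced map `A'/vIdeal' → A/vIdeal` exists and
is bijective. The global statement (these chart isomorphisms glue) is the owner's / row 110's.
[claim: Hu2025, status: under-review]
STATUS: candidate statement under adjudication (D-0012/D-0089); not asserted. -/
def Cor6_13_chart {A' : Type w} [CommRing A'] (isEllK fullChart0 : Prop) (π : A' →+* A) (vIdeal' : Ideal A')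
    (vIdeal : Ideal A) : Prop :=
  isEllK → fullChart0 →
    ∃ h : vIdeal' ≤ vIdeal.comap π, Function.Bijective (Ideal.quotientMap vIdeal π h)

/-- **Remark 6.14, its mathematical clause (C52L7–L11; p.117).** «The induced blowup 𝒱̃_{ℓ_k} → 𝒱̃_{℘_k} is an isomorphism
as it is a blowup along a Cartier divisor, which is also proved in the above Corollary 6.13.» (The rest of the remark,
C52L12–L26, is motivation: «had this blowup not performed here, then the "zero factor" δ_{𝔙,(m,u_{F_k})} would remain …
this would bring the author to an unknown territory» — prose, not typed.) Typed chart-level: the ℓ_k-centre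
`Z_{χ_k} ∩ 𝔙' = (δ', L⋆') ∩ 𝔙'` (proof of Prop. 6.11 (9), C51L57–L60) restricted to `𝒱̃_{℘_k} ∩ 𝔙'` is CARTIER, read as:
its image in `A' ⧸ vIdeal'` is a principal ideal generated by a non-zero-divisor (after shrinking the chart — the
printed «Cartier» is local principality; flagged).
[claim: Hu2025, status: under-review]
STATUS: candidate statement under adjudication (D-0012/D-0089); not asserted. -/
def Rem6_14_cartier {A' : Type w} [CommRing A'] (isWpK : Prop) (centre' vIdeal' : Ideal A') : Prop :=
  isWpK → ∃ g : A' ⧸ vIdeal', centre'.map (Ideal.Quotient.mk vIdeal') = Ideal.span {g} ∧ g ∈ nonZeroDivisors (A' ⧸ vIdeal')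

/-! ## Prop. 6.15 — smoothness of the proper transforms of the 𝔏-divisors -/

/-- **Proposition 6.15 (C52L28–L33; p.117).** «Not particularly used, using similar arguments to some of the above
proof, we can show Proposition 6.15. Let the notation be as in Proposition 6.11. Then, the proper transform of the
divisor D_{L_F} = (L_F = 0) in ℛ̃_{(℘_(kτ)𝔯_μ𝔰_h)} is smooth for all F̄ ∈ 𝔉.» Typed on an admissible chart: the
quotient of the chart ring by `(L_{𝔙,F})` is a smooth `R`-algebra, for every `F` (Prop. 5.11 third bullet:
«D_{ϑ[k],L} ∩ 𝔙 is defined by (L_{𝔙,F} = 0) … where L_{𝔙,F} is the proper transform of L_F», C37L74–L75).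
[claim: Hu2025, status: under-review]
STATUS: candidate statement under adjudication (D-0012/D-0089); not asserted. -/
def Prop6_15 (C : WpEllChart ι₁ ι₂ ιF ιE A) : Prop :=
  IsAdmissible C → ∀ F, IsSmoothAlg R (A ⧸ Ideal.span {C.ellForm F})

/-! ## Def. 6.17 — termination of a governing binomial on ℘/ℓ charts (cf. Def. 5.6 of row 106) -/

/-- **Definition 6.17, «terminates at 𝐳» (C53L20–L28; p.119).** «(cf. Definition 5.6) Consider any governing
binomial relation B ∈ ℬ^gov. Let 𝔙 be an admissible affine chart of ℛ̃_{(℘_(kτ)𝔯_μ𝔰_h)} (including ℛ̃_{ℓ_k}) and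
𝐳 ∈ 𝒱̃_{(℘_(kτ)𝔯_μ𝔰_h)} ∩ 𝔙 be a closed point. We say that B terminates at 𝐳 if (at least one, hence both of) its two
terms of B_𝔙 does not vanish at 𝐳.» Typed with the two terms `T^+_{𝔙,B}, T^-_{𝔙,B} ∈ A` of the proper transform
`B_𝔙` as explicit data (C53L35–L36 «we express B_𝔙 = T^+_{𝔙,B} − T^-_{𝔙,B}») and «closed point 𝐳 ∈ 𝒱̃ ∩ 𝔙» ↦ a
maximal ideal `𝔪 ⊇` the ideal of `𝒱̃ ∩ 𝔙`; «does not vanish at 𝐳» ↦ `∉ 𝔪`; «at least one» AS PRINTED (the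
parenthetical «hence both» is a claim, typed as `Def6_17_henceBoth`).
[claim: Hu2025, status: under-review]
STATUS: candidate statement under adjudication (D-0012/D-0089); not asserted. -/
def TerminatesAt₆ (C : WpEllChart ι₁ ι₂ ιF ιE A) (Tplus Tminus : A) (𝔪 : Ideal A) : Prop :=
  𝔪.IsMaximal ∧ C.vIdeal ≤ 𝔪 ∧ (Tplus ∉ 𝔪 ∨ Tminus ∉ 𝔪)

/-- **Definition 6.17, the parenthetical «(at least one, hence both of)» (C53L27; p.119) as a claim:** at a closed
point of `𝒱̃ ∩ 𝔙`, if one term of `B_𝔙` does not vanish then neither does the other. Hypothesis made explicit (T4;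
lane-B pre-read note N108-1, res-ref-b12 2026-08-27T07:20:02Z): `T⁺, T⁻` are «its two terms of B_𝔙» for a governing
binomial `B ∈ ℬ^gov` — «we express B_𝔙 = T^+_{𝔙,B} − T^-_{𝔙,B}» (C53L35–L36) — and `B_𝔙` vanishes on `𝒱̃ ∩ 𝔙` (the
scheme `𝒱̃_{(℘_(kτ)𝔯_μ𝔰_h)} ∩ 𝔙` «is defined by ℬ^gov_𝔙, ℬ^frb_𝔙, L_{𝔉,𝔙}», Prop. 6.18 headline C53L68–L75; standing
context at Def. 6.17, not re-stated there), rendered `Tplus - Tminus ∈ C.vIdeal`. Over ARBITRARY `Tplus Tminus : A` the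
bare implication is not a faithful reading (it fails for `T⁺ = 1`, `T⁻ ∈` the ideal of `𝒱̃ ∩ 𝔙`).
[claim: Hu2025, status: under-review]
STATUS: candidate statement under adjudication (D-0012/D-0089); not asserted. -/
def Def6_17_henceBoth (C : WpEllChart ι₁ ι₂ ιF ιE A) (Tplus Tminus : A) : Prop :=
  Tplus - Tminus ∈ C.vIdeal →
    ∀ 𝔪 : Ideal A, 𝔪.IsMaximal → C.vIdeal ≤ 𝔪 → (Tplus ∉ 𝔪 ∨ Tminus ∉ 𝔪) → (Tplus ∉ 𝔪 ∧ Tminus ∉ 𝔪)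

/-- **Definition 6.17, «terminates on the chart 𝔙» (C53L30–L31; p.119).** «We say B terminates on the chart 𝔙 if it
terminates at all closed points of 𝒱̃_{(℘_(kτ)𝔯_μ𝔰_h)} ∩ 𝔙.»
[claim: Hu2025, status: under-review]
STATUS: candidate statement under adjudication (D-0012/D-0089); not asserted. -/
def TerminatesOnChart (C : WpEllChart ι₁ ι₂ ιF ιE A) (Tplus Tminus : A) : Prop :=
  ∀ 𝔪 : Ideal A, 𝔪.IsMaximal → C.vIdeal ≤ 𝔪 → TerminatesAt₆ C Tplus Tminus 𝔪

/-- **Definition 6.17 under its printed name** (alias of `TerminatesOnChart`; C53L20–L31; p.119).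
[claim: Hu2025, status: under-review]
STATUS: candidate statement under adjudication (D-0012/D-0089); not asserted. -/
abbrev Def6_17 (C : WpEllChart ι₁ ι₂ ιF ιE A) (Tplus Tminus : A) : Prop := TerminatesOnChart C Tplus Tminus

/-- **Definition 6.17, «terminates on ℛ̃_{(℘_(kτ)𝔯_μ𝔰_h)}» (C53L32–L33; p.119).** «We say B terminates on
ℛ̃_{(℘_(kτ)𝔯_μ𝔰_h)} if it terminates on all admissible affine charts 𝔙 of ℛ̃_{(℘_(kτ)𝔯_μ𝔰_h)}.» Typed over an abstract
family of admissible charts (each with its own coordinate ring) and the terms of `B` on each chart, all explicit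
parameters (the scheme-level atlas is row 110's).
[claim: Hu2025, status: under-review]
STATUS: candidate statement under adjudication (D-0012/D-0089); not asserted. -/
def Def6_17_all {κ : Type*} (ring : κ → Type w) [∀ c, CommRing (ring c)]
    (chart : ∀ c, WpEllChart ι₁ ι₂ ιF ιE (ring c)) (Tplus Tminus : ∀ c, ring c) : Prop :=
  ∀ c, IsAdmissible (chart c) → TerminatesOnChart (chart c) (Tplus c) (Tminus c)

/-! ## Name concordance with lit/PARTITION-HU.md row 108 «expected decls» (aliases; same content) -/

/-- **Corollary 6.13 under PARTITION-HU row 108's expected name `Cor6_13`** (alias of the chart-level reading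
`Cor6_13_chart`; C51L152–L158; p.116: «ρ_{ℓ_k,℘_k} : 𝒱̃_{ℓ_k} → 𝒱̃_{℘_k} … is an isomorphism»; the scheme-level gluing
is row 110's).
[claim: Hu2025, status: under-review]
STATUS: candidate statement under adjudication (D-0012/D-0089); not asserted. -/
abbrev Cor6_13 {A' : Type w} [CommRing A'] (isEllK fullChart0 : Prop) (π : A' →+* A) (vIdeal' : Ideal A')
    (vIdeal : Ideal A) : Prop :=
  Cor6_13_chart isEllK fullChart0 π vIdeal' vIdeal

/-- **Remark 6.14 under PARTITION-HU row 108's expected name `Rem6_14`** (alias of its mathematical clause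
`Rem6_14_cartier`; C52L7–L11; p.117: «… is an isomorphism as it is a blowup along a Cartier divisor»).
[claim: Hu2025, status: under-review]
STATUS: candidate statement under adjudication (D-0012/D-0089); not asserted. -/
abbrev Rem6_14 {A' : Type w} [CommRing A'] (isWpK : Prop) (centre' vIdeal' : Ideal A') : Prop :=
  Rem6_14_cartier isWpK centre' vIdeal'

end Items

end Literature.AlgebraicGeometry.Hu2025.Statements.S06WpEllBlowups

end
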